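import Summits.BirchSwinnertonDyer.BirchSwinnertonDyer.Theorems.ByReductionTypeAtTwoOrdKatoHalfAtTwoIsoZetaColemanMuIotaLocPairing
import Literature.NumberTheory.EllipticCurves.Kato2004.LocalIwasawaCohomologyMap
import Literature.NumberTheory.EllipticCurves.Kato2004.IwasawaCohomologyExistsProofs
import HarnessLib

/-!
# Route ByReductionTypeAtTwo, crux `OrdKatoHalfAtTwoIso` (stmt-BirchSwinnertonDyer-19573), line `steinberg-fibre-at-two`,
# F1 slot (child stmt-BirchSwinnertonDyer-24097): F1μι⁻ BY NAME from exactly TWO typed inputs on KATO'S CARRIERS —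
# (W1+W3) «Λ-adic local duality + Poitou–Tate at `2`»: a pairing of `𝐇¹_{loc,Γ}(T₂W)` (`LocalIwasawaH1Data`) against
# `H¹(ℚ_∞, E[2^∞])` through `loc₂`, adjoint, `ℤ₂`-bilinear, onto the `loc₂`-characters, killing `𝐇¹_{loc,Γ}(F⁺T) × Sel`
# and `loc(𝐇¹_Γ) × Sel`; (W2) «Coleman/ERL at `2` on `Δ < 0`»: a `Λ`-linear `col` on `𝐇¹_{loc,Γ}(T₂W)` with kernel inside
# `𝐇¹_{loc,Γ}(F⁺T)` sending `loc` of a GENUINE class to `u·M·L′`, `μ(M) = 0`, `ι L′ = C r·L₂(f,α)`, `‖r‖₂ = 1`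

Seat `cruxlead-stmt-BirchSwinnertonDyer-19573-w3` g3 (prover WIDTH under the LEAD `cruxlead-19573`; HOME `run/shared/lean/pub/bsd-2adic/`;
`--supports` stmt-BirchSwinnertonDyer-24097). THEOREMS ONLY (no definition, no named fact, no `sorry`, no instance). HONEST FRAMING (cell
bsd-2adic): BSD is not proved by any of this; F1μι⁻, the `0 < Δ` conjunct and the crux are NOT proved here; both inputs are OPEN hypotheses
displayed in the theorem signatures (W1+W3 classical at every `p` — Tate local duality at the layers, `F⁺ ⊥ F⁺`, Poitou–Tate with the
real places —; W2 the one memo-grade reading — Kato 12.6 / 16.6 (2) / 17.12 on the `Γ`-tower at `2` with the period line of the lead's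
F-27a), NOT definitions and NOT Literature facts.

WHY. `…IotaLocPairing` reduced the per-datum local input to a pairing `toDualP : P₀ → Hom(H¹(ker κ, E[2^∞]), ℚ/ℤ)` + `col` + `ℓ₀` on an
ABSTRACT `Λ`-module `P₀`. Here `P₀ := J.H` for `J : LocalIwasawaH1Data κ v₂ ((tateRep W 2).toLocal v₂) γᵥ` and `ℓ₀ := I.loc J` (the tree's
pinned local Iwasawa cohomology and localisation, conv-1's carriers of `Kato2004/ZetaColemanMinusAtTwo.lean`), the isotropy clause
«`ker col ⊥ Sel`» is split into its two printed halves — `ker col ≤ range (J'.ordinaryInclusion J)` (Kato 17.12: `col` factors through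
`T ↠ T/F⁺T` and is injective there) and «`range ordinaryInclusion ⊥ Sel`» (the Kummer condition lies in `im H¹(F⁺A)`, and `F⁺ ⊥ F⁺`) —
and reciprocity is asked for ALL of `𝐇¹_Γ` (Poitou–Tate is about global classes). The carriers `γᵥ, J, J′, I` EXIST
(`exists_isTopGenerator_resGalOfEmb_adicCompletion`, `surjective_comp_resGalOfEmb_of_isCyclotomic`, `nonempty_localIwasawaH1Data`,
`nonempty_iwasawaH1Data_holds`), so the door below quantifies the inputs over ALL carriers and instantiates them at chosen ones.

* `zetaColemanMuIotaNegDiscAtTwo_of_katoCarriers` — (W1+W3) ∧ (W2) ⇒ `ZetaColemanMuIotaNegDiscAtTwo` (lead's def p693557) BY NAME.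
* `ordKatoFineZetaAtTwoResidue_of_katoCarriers_of_posDisc` — + the `0 < Δ` conjunct ⇒ item 24097 BY NAME.

References: [Kato2004Asterisque] Thm 12.6 (p. 222), (14.9.3) (p. 240), Thm 16.6 (2) (p. 271), Lemma 17.9, Prop 17.11, Lemma 17.12
(pp. 275–279), §17.13 (pp. 279–280); [MilneADT2006] I Cor. 2.3, I Thm 4.10; [GreenbergLNM1716] §2 (pp. 69–74); [Washington1997] §13.1–13.2;
tree `Kato2004/LocalIwasawaCohomology{,Map}.lean`, `Kato2004/IwasawaCohomologyExistsProofs.lean`, `Kato2004/ZetaColemanMinusAtTwo.lean`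
(conv-1, the λ-twin of W2), this seat's `…IotaAdjointTranspose` / `…IotaAdjointPairing` / `…IotaLocPairing`.
-/

set_option autoImplicit false
set_option linter.dupNamespace false

noncomputable section

open scoped Classical MatrixGroups ModularForm NumberField
open CongruenceSubgroup WeierstrassCurve Field IsDedekindDomain NumberField
open Literature.NumberTheory.GaloisRepresentations
open Literature.NumberTheory.GaloisCohomology
open Literature.NumberTheory.EllipticCurves Literature.NumberTheory.EllipticCurves.ModularForms
  Literature.NumberTheory.EllipticCurves.GreenbergSelmer
open Literature.NumberTheory.EllipticCurves.Kato2004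
  Literature.NumberTheory.EllipticCurves.Kato2004.EulerSystemValues
open Literature.NumberTheory.EllipticCurves.IwasawaDual
open Literature.NumberTheory.EllipticCurves.Rank1Residual
open Literature.NumberTheory.EllipticCurves.Greenberg1999
open Summit.BirchSwinnertonDyer.Rank1Residual Summit.BirchSwinnertonDyer.Rank1Residual.X5
open Summit.BirchSwinnertonDyer.BirchSwinnertonDyer.Theorems.OrdKatoOptimalAtTwo
  Summit.BirchSwinnertonDyer.BirchSwinnertonDyer.Theorems.OrdKatoIntAtTwo
open Summit.BirchSwinnertonDyer.BirchSwinnertonDyer.Theses.ByReductionTypeAtTwo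

namespace Summit.BirchSwinnertonDyer.BirchSwinnertonDyer.Theorems.SteinbergFibreAtTwo

/-- **F1μι⁻ = `ZetaColemanMuIotaNegDiscAtTwo` BY NAME from the two typed inputs on Kato's carriers.**
`hpairPT` (W1+W3; classical at every `p`): for every `W` good ordinary at `2`, cyclotomic `(κ, γ)` with `κ γ = 1`, every place `v₂ ∋ 2`,
local normalised generator `γᵥ`, and ALL pinned carriers `I = 𝐇¹_Γ(T₂W)`, `J = 𝐇¹_{loc,Γ}(T₂W|_{Γ_{ℚ₂}})`, `J′ = 𝐇¹_{loc,Γ}(F⁺T₂W)`, a pairing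
`toDualP : J.H → Hom(H¹(ker κ, E[2^∞]), ℚ/ℤ)` (print: `u ↦ (s ↦ lim_n inv(u_n ∪ res_{v₂} s))`) which (K) factors through `loc_{v₂}`, (T) is
adjoint for `γ ↔ γ⁻¹`, (C) is `ℤ₂`-bilinear on torsion values, (S) is onto the `loc_{v₂}`-characters, (I) kills `range(𝐇¹_{loc,Γ}(F⁺T)) × Sel`,
(R) kills `loc(𝐇¹_Γ) × Sel`. `hcolERL` (W2; the reading, `Δ < 0`): a `Λ`-linear `col : J.H → Λ` with `ker col ≤ range(J′ → J)` and a GENUINE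
class `g ∈ 𝐇¹_Γ` with `col (loc g) = u·M·L′`, `M ∉ (2)`, `ι L′ = C r·L₂(f, α)`, `‖r‖₂ = 1`. Proof: choose `v₂, γᵥ, J, J′, I` (they exist),
instantiate both inputs there, and apply `zetaColemanMuTheta_invol_datum_of_locPairing_erl` with `P₀ := J.H`, `ℓ₀ := I.loc J`, `G := {g}`.
[cite: Kato2004Asterisque, Thm 12.6 (p. 222), (14.9.3) (p. 240), Thm 16.6 (2) (p. 271), Lemma 17.9, Prop 17.11, Lemma 17.12 (pp. 275–279), §17.13 (pp. 279–280)]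
[cite: MilneADT2006, Ch. I, Cor. 2.3 and Thm. 4.10] [cite: GreenbergLNM1716, §2 (pp. 69–74)] -/
theorem zetaColemanMuIotaNegDiscAtTwo_of_katoCarriers
    (hpairPT : ∀ (W : WeierstrassCurve ℚ) [W.IsElliptic] [W.IsGloballyMinimal]
      [ContinuousSMul ℤ_[2] (W.tateModule 2)] [Module.Free ℤ_[2] (W.tateModule 2)] [Module.Finite ℤ_[2] (W.tateModule 2)]
      (κ : ZpExtension ℚ 2) (γ : absoluteGaloisGroup ℚ) (_hκ : κ.IsCyclotomic) (hγ : κ.IsTopGenerator γ),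
      IsOrdinaryAt W 2 →
      ∀ (v₂ : HeightOneSpectrum (𝓞 ℚ)) (_ : ((2 : ℕ) : 𝓞 ℚ) ∈ v₂.asIdeal)
        (γᵥ : absoluteGaloisGroup (v₂.adicCompletion ℚ))
        (hsurj : Function.Surjective
          (κ.toContinuousMonoidHom.comp (resGalOfEmb (closureEmb (K := ℚ) (v₂.adicCompletion ℚ)))))
        (hγᵥ : κ.IsTopGenerator (resGalOfEmb (closureEmb (K := ℚ) (v₂.adicCompletion ℚ)) γᵥ))
        (I : IwasawaH1Data W 2 κ γ) (J : LocalIwasawaH1Data κ v₂ ((tateRep W 2).toLocal v₂) γᵥ)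
        (J' : LocalIwasawaH1Data κ v₂ (tateLocalOrdinaryRep W 2 v₂) γᵥ),
      ∃ toDualP : J.H →+ (W.subgroupH1 2 κ.kerSubgroup →+ AddCircle (1 : ℚ)),
        (∀ (x : J.H) (s : W.subgroupH1 2 κ.kerSubgroup),
          W.resOfLe 2 (inf_le_left : κ.kerSubgroup ⊓ decomp v₂ ≤ κ.kerSubgroup) s = 0 → toDualP x s = 0) ∧
        (∀ (x : J.H) (s : W.subgroupH1 2 κ.kerSubgroup),
          toDualP ((PowerSeries.X : IwasawaAlgebra 2) • x) s =
            toDualP x (W.conjH1 2 κ.kerSubgroup γ⁻¹ s) - toDualP x s) ∧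
        (∀ (c : ℤ_[2]) (x : J.H) (s : W.subgroupH1 2 κ.kerSubgroup) (k : ℕ), 2 ^ k • toDualP x s = 0 →
          toDualP (PowerSeries.C c • x) s = (PadicInt.toZModPow k c).val • toDualP x s) ∧
        (∀ χ : W.subgroupH1 2 κ.kerSubgroup →+ AddCircle (1 : ℚ),
          (∀ s, W.resOfLe 2 (inf_le_left : κ.kerSubgroup ⊓ decomp v₂ ≤ κ.kerSubgroup) s = 0 → χ s = 0) →
            ∃ x : J.H, toDualP x = χ) ∧
        (∀ (y : J'.H) (s : W.selmerInfty κ), toDualP (J'.ordinaryInclusion J y) s = 0) ∧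
        (∀ (g : I.H) (s : W.selmerInfty κ), toDualP (I.loc J hsurj hγ hγᵥ g) s = 0))
    (hcolERL : ∀ (W : WeierstrassCurve ℚ) [W.IsElliptic] [W.IsGloballyMinimal]
      [ContinuousSMul ℤ_[2] (W.tateModule 2)] [Module.Free ℤ_[2] (W.tateModule 2)] [Module.Finite ℤ_[2] (W.tateModule 2)]
      {N : ℕ} [NeZero N] (f : CuspForm (Gamma0 N) 2)
      (κ : ZpExtension ℚ 2) (γ : absoluteGaloisGroup ℚ) (hκ : κ.IsCyclotomic) (hγ : κ.IsTopGenerator γ),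
      W.Δ < 0 → IsOrdinaryAt W 2 → W.HasSurjectiveModNGaloisRep 2 → IsCyclotomicVariable 2 γ → IsNewformOf W f →
      ∀ (v₂ : HeightOneSpectrum (𝓞 ℚ)) (_ : ((2 : ℕ) : 𝓞 ℚ) ∈ v₂.asIdeal)
        (γᵥ : absoluteGaloisGroup (v₂.adicCompletion ℚ))
        (hsurj : Function.Surjective
          (κ.toContinuousMonoidHom.comp (resGalOfEmb (closureEmb (K := ℚ) (v₂.adicCompletion ℚ)))))
        (hγᵥ : κ.IsTopGenerator (resGalOfEmb (closureEmb (K := ℚ) (v₂.adicCompletion ℚ)) γᵥ))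
        (I : IwasawaH1Data W 2 κ γ) (J : LocalIwasawaH1Data κ v₂ ((tateRep W 2).toLocal v₂) γᵥ)
        (J' : LocalIwasawaH1Data κ v₂ (tateLocalOrdinaryRep W 2 v₂) γᵥ),
      ∃ col : J.H →ₗ[IwasawaAlgebra 2] IwasawaAlgebra 2,
        (∀ x : J.H, col x = 0 → x ∈ LinearMap.range (J'.ordinaryInclusion J)) ∧
        ∃ g : I.H, IsEulerSystemClassTwo W hκ I g ∧
          ∃ (u : (IwasawaAlgebra 2)ˣ) (M L' : IwasawaAlgebra 2) (r : ℚ_[2]),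
            M ∉ IwasawaAlgebra.augIdealP 2 ∧ ‖r‖ = 1 ∧
              iwasawaToPowerSeries 2 L' = PowerSeries.C r * padicLFunction f (unitRoot W 2 : ℚ_[2]) ∧
              col (I.loc J hsurj hγ hγᵥ g) = (u : IwasawaAlgebra 2) * M * L') :
    ZetaColemanMuIotaNegDiscAtTwo := by
  intro W _ _ _ _ _ N _ f κ γ hκ hord h2 hΔ hγ hγ' hf D Y
  -- the carriers: the place above `2`, a normalised local generator, the pinned local modules, the pinned global module
  obtain ⟨v₂, hv₂⟩ : ∃ v : HeightOneSpectrum (𝓞 ℚ), ((2 : ℕ) : 𝓞 ℚ) ∈ v.asIdeal :=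
    ⟨(Rat.HeightOneSpectrum.primesEquiv (R := 𝓞 ℚ)).symm ⟨2, Nat.prime_two⟩,
      (natCast_mem_asIdeal_iff_eq_primesEquiv_symm _ Nat.prime_two).mpr rfl⟩
  obtain ⟨γᵥ, hγᵥ⟩ := hκ.exists_isTopGenerator_resGalOfEmb_adicCompletion v₂ hv₂
  have hsurj := surjective_comp_resGalOfEmb_of_isCyclotomic (κ := κ) (v := v₂) hκ hv₂
  obtain ⟨J⟩ := nonempty_localIwasawaH1Data κ v₂ ((tateRep W 2).toLocal v₂) γᵥ
  obtain ⟨J'⟩ := nonempty_localIwasawaH1Data κ v₂ (tateLocalOrdinaryRep W 2 v₂) γᵥ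
  obtain ⟨I⟩ := nonempty_iwasawaH1Data_holds W 2 κ γ hκ hγ
  -- the two inputs at these carriers
  obtain ⟨toDualP, hK, hT, hC, hS, hiso, hPT⟩ := hpairPT W κ γ hκ hγ hord v₂ hv₂ γᵥ hsurj hγᵥ I J J'
  obtain ⟨col, hker, g, hg, u, M, L', r, hM, hr, hL', hcol⟩ :=
    hcolERL W f κ γ hκ hγ hΔ hord h2 hγ' hf v₂ hv₂ γᵥ hsurj hγᵥ I J J'
  -- isotropy of `ker col`: it lies in the ordinary part, which pairs to zero with `Sel`
  have hcolφ : ∀ x : J.H, col x = 0 → ∀ s : W.selmerInfty κ, toDualP x s = 0 := by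
    intro x hx s
    obtain ⟨y, rfl⟩ := hker x hx
    exact hiso y s
  have hG : ∀ g' ∈ ({g} : Set I.H), IsEulerSystemClassTwo W hκ I g' := by
    intro g' hg'
    rw [Set.mem_singleton_iff] at hg'
    rw [hg']
    exact hg
  have hrecG : ∀ g' ∈ ({g} : Set I.H), ∀ s : W.selmerInfty κ, toDualP (I.loc J hsurj hγ hγᵥ g') s = 0 :=
    fun g' _ s => hPT g' s
  have herl : ∃ g' ∈ ({g} : Set I.H), ∃ (u : (IwasawaAlgebra 2)ˣ) (M L' : IwasawaAlgebra 2) (r : ℚ_[2]),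
      M ∉ IwasawaAlgebra.augIdealP 2 ∧ ‖r‖ = 1 ∧
        iwasawaToPowerSeries 2 L' = PowerSeries.C r * padicLFunction f (unitRoot W 2 : ℚ_[2]) ∧
        col (I.loc J hsurj hγ hγᵥ g') = (u : IwasawaAlgebra 2) * M * L' :=
    ⟨g, Set.mem_singleton g, u, M, L', r, hM, hr, hL', hcol⟩
  obtain ⟨Z, P, ℓ, τ, π, h⟩ := zetaColemanMuTheta_invol_datum_of_locPairing_erl D Y I {g} hG v₂ hv₂ toDualP hK hT hC hS
    col hcolφ (I.loc J hsurj hγ hγᵥ) hrecG herl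
  exact ⟨I, Z, P, ℓ, τ, π, h⟩

/-- **The post-P8′ F1 child `OrdKatoFineZetaAtTwoResidue` (stmt-BirchSwinnertonDyer-24097) BY NAME from the two typed inputs on
Kato's carriers and its `0 < Δ` conjunct** (`OrdKatoHalfAtTwoIsoPosDisc`, RESEARCH, passed through). CONDITIONAL; nothing closed.
[cite: Kato2004Asterisque, §17.13 (pp. 279–280)] [cite: GreenbergLNM1716, Conj. 1.11 (p. 64) (shape)] -/
theorem ordKatoFineZetaAtTwoResidue_of_katoCarriers_of_posDisc
    (hpairPT : ∀ (W : WeierstrassCurve ℚ) [W.IsElliptic] [W.IsGloballyMinimal]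
      [ContinuousSMul ℤ_[2] (W.tateModule 2)] [Module.Free ℤ_[2] (W.tateModule 2)] [Module.Finite ℤ_[2] (W.tateModule 2)]
      (κ : ZpExtension ℚ 2) (γ : absoluteGaloisGroup ℚ) (_hκ : κ.IsCyclotomic) (hγ : κ.IsTopGenerator γ),
      IsOrdinaryAt W 2 →
      ∀ (v₂ : HeightOneSpectrum (𝓞 ℚ)) (_ : ((2 : ℕ) : 𝓞 ℚ) ∈ v₂.asIdeal)
        (γᵥ : absoluteGaloisGroup (v₂.adicCompletion ℚ))
        (hsurj : Function.Surjective
          (κ.toContinuousMonoidHom.comp (resGalOfEmb (closureEmb (K := ℚ) (v₂.adicCompletion ℚ)))))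
        (hγᵥ : κ.IsTopGenerator (resGalOfEmb (closureEmb (K := ℚ) (v₂.adicCompletion ℚ)) γᵥ))
        (I : IwasawaH1Data W 2 κ γ) (J : LocalIwasawaH1Data κ v₂ ((tateRep W 2).toLocal v₂) γᵥ)
        (J' : LocalIwasawaH1Data κ v₂ (tateLocalOrdinaryRep W 2 v₂) γᵥ),
      ∃ toDualP : J.H →+ (W.subgroupH1 2 κ.kerSubgroup →+ AddCircle (1 : ℚ)),
        (∀ (x : J.H) (s : W.subgroupH1 2 κ.kerSubgroup),
          W.resOfLe 2 (inf_le_left : κ.kerSubgroup ⊓ decomp v₂ ≤ κ.kerSubgroup) s = 0 → toDualP x s = 0) ∧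
        (∀ (x : J.H) (s : W.subgroupH1 2 κ.kerSubgroup),
          toDualP ((PowerSeries.X : IwasawaAlgebra 2) • x) s =
            toDualP x (W.conjH1 2 κ.kerSubgroup γ⁻¹ s) - toDualP x s) ∧
        (∀ (c : ℤ_[2]) (x : J.H) (s : W.subgroupH1 2 κ.kerSubgroup) (k : ℕ), 2 ^ k • toDualP x s = 0 →
          toDualP (PowerSeries.C c • x) s = (PadicInt.toZModPow k c).val • toDualP x s) ∧
        (∀ χ : W.subgroupH1 2 κ.kerSubgroup →+ AddCircle (1 : ℚ),
          (∀ s, W.resOfLe 2 (inf_le_left : κ.kerSubgroup ⊓ decomp v₂ ≤ κ.kerSubgroup) s = 0 → χ s = 0) →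
            ∃ x : J.H, toDualP x = χ) ∧
        (∀ (y : J'.H) (s : W.selmerInfty κ), toDualP (J'.ordinaryInclusion J y) s = 0) ∧
        (∀ (g : I.H) (s : W.selmerInfty κ), toDualP (I.loc J hsurj hγ hγᵥ g) s = 0))
    (hcolERL : ∀ (W : WeierstrassCurve ℚ) [W.IsElliptic] [W.IsGloballyMinimal]
      [ContinuousSMul ℤ_[2] (W.tateModule 2)] [Module.Free ℤ_[2] (W.tateModule 2)] [Module.Finite ℤ_[2] (W.tateModule 2)]
      {N : ℕ} [NeZero N] (f : CuspForm (Gamma0 N) 2)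
      (κ : ZpExtension ℚ 2) (γ : absoluteGaloisGroup ℚ) (hκ : κ.IsCyclotomic) (hγ : κ.IsTopGenerator γ),
      W.Δ < 0 → IsOrdinaryAt W 2 → W.HasSurjectiveModNGaloisRep 2 → IsCyclotomicVariable 2 γ → IsNewformOf W f →
      ∀ (v₂ : HeightOneSpectrum (𝓞 ℚ)) (_ : ((2 : ℕ) : 𝓞 ℚ) ∈ v₂.asIdeal)
        (γᵥ : absoluteGaloisGroup (v₂.adicCompletion ℚ))
        (hsurj : Function.Surjective
          (κ.toContinuousMonoidHom.comp (resGalOfEmb (closureEmb (K := ℚ) (v₂.adicCompletion ℚ)))))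
        (hγᵥ : κ.IsTopGenerator (resGalOfEmb (closureEmb (K := ℚ) (v₂.adicCompletion ℚ)) γᵥ))
        (I : IwasawaH1Data W 2 κ γ) (J : LocalIwasawaH1Data κ v₂ ((tateRep W 2).toLocal v₂) γᵥ)
        (J' : LocalIwasawaH1Data κ v₂ (tateLocalOrdinaryRep W 2 v₂) γᵥ),
      ∃ col : J.H →ₗ[IwasawaAlgebra 2] IwasawaAlgebra 2,
        (∀ x : J.H, col x = 0 → x ∈ LinearMap.range (J'.ordinaryInclusion J)) ∧
        ∃ g : I.H, IsEulerSystemClassTwo W hκ I g ∧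
          ∃ (u : (IwasawaAlgebra 2)ˣ) (M L' : IwasawaAlgebra 2) (r : ℚ_[2]),
            M ∉ IwasawaAlgebra.augIdealP 2 ∧ ‖r‖ = 1 ∧
              iwasawaToPowerSeries 2 L' = PowerSeries.C r * padicLFunction f (unitRoot W 2 : ℚ_[2]) ∧
              col (I.loc J hsurj hγ hγᵥ g) = (u : IwasawaAlgebra 2) * M * L')
    (hPos : OrdKatoHalfAtTwoIsoPosDisc) : OrdKatoFineZetaAtTwoResidue :=
  ⟨zetaColemanMuIotaNegDiscAtTwo_of_katoCarriers hpairPT hcolERL, hPos⟩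

end Summit.BirchSwinnertonDyer.BirchSwinnertonDyer.Theorems.SteinbergFibreAtTwo

end
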